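import Mathlib.Data.Fin.Tuple.Sort
import Mathlib.Algebra.Order.Group.PiLex
import Summits.HodgeConjecture.HodgeConjecture.Theorems.TropicalWeilObstructionTropicalWeilVanishingIntegralityHomotopy
import HarnessLib

/-!
# Route `TropicalWeilObstruction` (Kontsevich's tropical test — NEGATION SINK, exploration, no summit claim):
# full integrality of the tropical cycle class — II. antisymmetrisation along a linear order ("sorting is a chain map")

Negation-sink bookkeeping of the cell `pub-hodge-tropical` (seat tropical-2 gen 6); part II of three of FULL INTEGRALITY
`24 ∣ intCoord Z` (part I: `…IntegralityHomotopy`, p344721; part III: `…Integrality`). The certificate format of an effective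
tropical cycle matches facets only up to translation AND RE-ORDERING (with sign), so only ALTERNATING cochains can be summed
against it, while the cup product `C` and its homotopy `Ψ` of part I (`D = 24·C + δΨ`) are not alternating. This file
antisymmetrises them along an arbitrary linear order on the points (`V` any linear order; part III takes the translation-
invariant lexicographic order on `ℤᵍ`): for a cochain `G` on `5`-tuples (resp. `H` on `4`-tuples) put
`𝐀G(x) = Σ_{ρ ∈ S₅} [x∘ρ strictly increasing] · sign ρ · G(x∘ρ)` (display-only notation). Then:

* `antisym₅_comp_perm`, `antisym₄_comp_perm` — `𝐀G` is alternating; `antisym₅_of_strictMono`, `antisym₄_of_strictMono` —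
  `𝐀G = G` on increasing tuples (uniqueness of sorting, Mathlib `Tuple.unique_monotone`);
* `faceSum_comp_perm` — the face sum `x ↦ Σ_i (-1)^i 𝐀H(x∘δ_i)` is alternating (part I's induced-sign lemma
  `exists_perm_succAbove`); `eq_zero_of_alternating` — alternating functions vanish on tuples with a repeated point;
* **`antisymmetrisation_identity`** — if `F` is alternating and `F = 24·G + δH` on increasing `5`-tuples, then
  `F = 24·𝐀G + δ(𝐀H)` on ALL `5`-tuples (sort by `Tuple.sort`, or kill everything by a transposition of two equal points);
* `antisym₄_add_const` — in an ordered additive group, `𝐀H` is translation invariant when `H` is.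

HONEST STATUS. Elementary; decides nothing about K1 (`TropicalWeilVanishing`, stmt-HodgeConjecture-18478, an OPEN problem) or
about the Hodge conjecture. No definition (display-only notation), no named fact, no sorry.

References: [MikhalkinZharkov2014Eigenwave] G. Mikhalkin, I. Zharkov, Tropical eigenwave and intermediate Jacobians,
LN UMI 15 (2014), Prop. 4.3.
-/

set_option linter.dupNamespace false

open scoped BigOperators

namespace Summit.HodgeConjecture.HodgeConjecture.Theorems.TropicalWeilVanishing.Integrality

/-! ## §0 Display-only notation (nothing is defined) -/

open Classical in
/-- Antisymmetrisation of a cochain `G` on ordered `5`-tuples along the order: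
`𝐀₅⟦G, x⟧ = Σ_{ρ ∈ S₅} [x∘ρ strictly increasing] · sign ρ · G(x∘ρ)`. Nothing is defined. -/
local notation3 (prettyPrint := false) "𝐀₅⟦" G "," x "⟧" =>
  (∑ ρ : Equiv.Perm (Fin 5),
    (if StrictMono (x ∘ ⇑ρ) then ((Equiv.Perm.sign ρ : ℤˣ) : ℤ) * G (x ∘ ⇑ρ) else (0 : ℤ)))

open Classical in
/-- Antisymmetrisation of a cochain `H` on ordered `4`-tuples:
`𝐀₄⟦H, y⟧ = Σ_{ρ ∈ S₄} [y∘ρ strictly increasing] · sign ρ · H(y∘ρ)`. Nothing is defined. -/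
local notation3 (prettyPrint := false) "𝐀₄⟦" H "," y "⟧" =>
  (∑ ρ : Equiv.Perm (Fin 4),
    (if StrictMono (y ∘ ⇑ρ) then ((Equiv.Perm.sign ρ : ℤˣ) : ℤ) * H (y ∘ ⇑ρ) else (0 : ℤ)))

variable {V : Type*} [LinearOrder V]

/-! ## §1 The antisymmetrisations are alternating, and trivial on increasing tuples -/

/-- `𝐀₅G` is alternating: `𝐀₅G(x∘τ) = sign τ · 𝐀₅G(x)`. [folklore] -/
theorem antisym₅_comp_perm (G : (Fin 5 → V) → ℤ) (x : Fin 5 → V) (τ : Equiv.Perm (Fin 5)) :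
    𝐀₅⟦G, x ∘ ⇑τ⟧ = ((Equiv.Perm.sign τ : ℤˣ) : ℤ) * 𝐀₅⟦G, x⟧ := by
  classical
  rw [Finset.mul_sum, ← Equiv.sum_comp (Equiv.mulLeft τ⁻¹)]
  refine Finset.sum_congr rfl fun ρ _ => ?_
  have hc : (x ∘ ⇑τ) ∘ ⇑((Equiv.mulLeft τ⁻¹) ρ) = x ∘ ⇑ρ := by
    funext k
    simp
  rw [hc]
  by_cases h : StrictMono (x ∘ ⇑ρ)
  · rw [if_pos h, if_pos h]
    have hs : ((Equiv.Perm.sign ((Equiv.mulLeft τ⁻¹) ρ) : ℤˣ) : ℤ) =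
        ((Equiv.Perm.sign τ : ℤˣ) : ℤ) * ((Equiv.Perm.sign ρ : ℤˣ) : ℤ) := by
      simp only [Equiv.coe_mulLeft, map_mul, map_inv, Units.val_mul]
      rw [Int.units_inv_eq_self]
    rw [hs]; ring
  · rw [if_neg h, if_neg h, mul_zero]

/-- `𝐀₄H` is alternating: `𝐀₄H(y∘τ) = sign τ · 𝐀₄H(y)`. [folklore] -/
theorem antisym₄_comp_perm (H : (Fin 4 → V) → ℤ) (y : Fin 4 → V) (τ : Equiv.Perm (Fin 4)) :
    𝐀₄⟦H, y ∘ ⇑τ⟧ = ((Equiv.Perm.sign τ : ℤˣ) : ℤ) * 𝐀₄⟦H, y⟧ := by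
  classical
  rw [Finset.mul_sum, ← Equiv.sum_comp (Equiv.mulLeft τ⁻¹)]
  refine Finset.sum_congr rfl fun ρ _ => ?_
  have hc : (y ∘ ⇑τ) ∘ ⇑((Equiv.mulLeft τ⁻¹) ρ) = y ∘ ⇑ρ := by
    funext k
    simp
  rw [hc]
  by_cases h : StrictMono (y ∘ ⇑ρ)
  · rw [if_pos h, if_pos h]
    have hs : ((Equiv.Perm.sign ((Equiv.mulLeft τ⁻¹) ρ) : ℤˣ) : ℤ) =
        ((Equiv.Perm.sign τ : ℤˣ) : ℤ) * ((Equiv.Perm.sign ρ : ℤˣ) : ℤ) := by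
      simp only [Equiv.coe_mulLeft, map_mul, map_inv, Units.val_mul]
      rw [Int.units_inv_eq_self]
    rw [hs]; ring
  · rw [if_neg h, if_neg h, mul_zero]

/-- On a strictly increasing `5`-tuple only `ρ = 1` contributes: `𝐀₅G(x) = G(x)`. [folklore] -/
theorem antisym₅_of_strictMono (G : (Fin 5 → V) → ℤ) {x : Fin 5 → V} (hx : StrictMono x) :
    𝐀₅⟦G, x⟧ = G x := by
  classical
  rw [Finset.sum_eq_single (1 : Equiv.Perm (Fin 5))]
  · simp [hx]
  · intro ρ _ hρ
    rw [if_neg]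
    intro hρm
    apply hρ
    have h1 : x ∘ ⇑ρ = x ∘ ⇑(1 : Equiv.Perm (Fin 5)) :=
      Tuple.unique_monotone hρm.monotone (by simpa using hx.monotone)
    exact Equiv.ext fun k => hx.injective (congr_fun h1 k)
  · intro h; exact absurd (Finset.mem_univ _) h

/-- On a strictly increasing `4`-tuple only `ρ = 1` contributes: `𝐀₄H(y) = H(y)`. [folklore] -/
theorem antisym₄_of_strictMono (H : (Fin 4 → V) → ℤ) {y : Fin 4 → V} (hy : StrictMono y) :
    𝐀₄⟦H, y⟧ = H y := by
  classical
  rw [Finset.sum_eq_single (1 : Equiv.Perm (Fin 4))]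
  · simp [hy]
  · intro ρ _ hρ
    rw [if_neg]
    intro hρm
    apply hρ
    have h1 : y ∘ ⇑ρ = y ∘ ⇑(1 : Equiv.Perm (Fin 4)) :=
      Tuple.unique_monotone hρm.monotone (by simpa using hy.monotone)
    exact Equiv.ext fun k => hy.injective (congr_fun h1 k)
  · intro h; exact absurd (Finset.mem_univ _) h

/-! ## §2 The face sum of an alternating `3`-cochain is alternating -/

/-- **The boundary pairing of `𝐀₄H` is alternating in the five points**:
`Σ_i (-1)^i 𝐀₄H((x∘τ)∘δ_i) = sign τ · Σ_i (-1)^i 𝐀₄H(x∘δ_i)` (part I's induced-sign lemma). [folklore] -/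
theorem faceSum_comp_perm (H : (Fin 4 → V) → ℤ) (x : Fin 5 → V) (τ : Equiv.Perm (Fin 5)) :
    ∑ i : Fin 5, (-1 : ℤ) ^ (i : ℕ) * 𝐀₄⟦H, (x ∘ ⇑τ) ∘ i.succAbove⟧ =
      ((Equiv.Perm.sign τ : ℤˣ) : ℤ) * ∑ i : Fin 5, (-1 : ℤ) ^ (i : ℕ) * 𝐀₄⟦H, x ∘ i.succAbove⟧ := by
  classical
  have step : ∀ i : Fin 5, (-1 : ℤ) ^ (i : ℕ) * 𝐀₄⟦H, (x ∘ ⇑τ) ∘ i.succAbove⟧ =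
      ((Equiv.Perm.sign τ : ℤˣ) : ℤ) * ((-1 : ℤ) ^ ((τ i : Fin 5) : ℕ) * 𝐀₄⟦H, x ∘ (τ i).succAbove⟧) := by
    intro i
    obtain ⟨θ, hθ, hsign⟩ := exists_perm_succAbove τ i
    have hc : (x ∘ ⇑τ) ∘ i.succAbove = (x ∘ (τ i).succAbove) ∘ ⇑θ := by
      funext k
      simp only [Function.comp_apply, hθ k]
    rw [hc, antisym₄_comp_perm]
    have hs : ((Equiv.Perm.sign θ : ℤˣ) : ℤ) =
        ((Equiv.Perm.sign τ : ℤˣ) : ℤ) * (-1) ^ (((τ i : Fin 5) : ℕ) + (i : ℕ)) := by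
      rw [hsign, Units.val_mul]; rfl
    rw [hs]
    have hsq : (-1 : ℤ) ^ (i : ℕ) * (-1 : ℤ) ^ (i : ℕ) = 1 := by
      rw [← pow_add, ← two_mul, pow_mul]; simp
    rw [pow_add]
    linear_combination ((Equiv.Perm.sign τ : ℤˣ) : ℤ) * (-1 : ℤ) ^ ((τ i : Fin 5) : ℕ) *
      𝐀₄⟦H, x ∘ (τ i).succAbove⟧ * hsq
  simp_rw [step]
  rw [← Finset.mul_sum]
  congr 1
  exact Equiv.sum_comp τ (fun j => (-1 : ℤ) ^ (j : ℕ) * 𝐀₄⟦H, x ∘ j.succAbove⟧)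

/-! ## §3 Alternating functions vanish on tuples with a repeated point -/

omit [LinearOrder V] in
/-- An alternating `ℤ`-valued function of `n` points vanishes when two of the points coincide
(swap them: `f = -f`). [folklore] -/
theorem eq_zero_of_alternating {n : ℕ} (f : (Fin n → V) → ℤ)
    (hf : ∀ (x : Fin n → V) (τ : Equiv.Perm (Fin n)), f (x ∘ ⇑τ) = ((Equiv.Perm.sign τ : ℤˣ) : ℤ) * f x)
    {x : Fin n → V} (hx : ¬Function.Injective x) : f x = 0 := by
  classical
  obtain ⟨p, q, hpq, hne⟩ : ∃ p q, x p = x q ∧ p ≠ q := by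
    simpa [Function.Injective, not_forall] using hx
  have hswap : x ∘ ⇑(Equiv.swap p q) = x := by
    funext k
    simp only [Function.comp_apply]
    rcases eq_or_ne k p with rfl | hkp
    · rw [Equiv.swap_apply_left, hpq]
    · rcases eq_or_ne k q with rfl | hkq
      · rw [Equiv.swap_apply_right, hpq]
      · rw [Equiv.swap_apply_of_ne_of_ne hkp hkq]
  have h := hf x (Equiv.swap p q)
  rw [hswap, Equiv.Perm.sign_swap hne, Units.val_neg, Units.val_one] at h
  linarith

/-! ## §4 The antisymmetrisation identity -/

/-- **Sorting is a chain map (the one identity part III needs).** If `F` is alternating on `5`-tuples and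
`F = 24·G + δH` holds on STRICTLY INCREASING `5`-tuples, then `F = 24·𝐀₅G + δ(𝐀₄H)` holds on ALL `5`-tuples:
`F(x) = 24·𝐀₅G(x) + Σ_i (-1)^i 𝐀₄H(x∘δ_i)`. (Injective `x`: sort it by `Tuple.sort` and transport by the alternation
of all three pieces; otherwise all three vanish.) [folklore] -/
theorem antisymmetrisation_identity (F G : (Fin 5 → V) → ℤ) (H : (Fin 4 → V) → ℤ)
    (hF : ∀ (x : Fin 5 → V) (τ : Equiv.Perm (Fin 5)), F (x ∘ ⇑τ) = ((Equiv.Perm.sign τ : ℤˣ) : ℤ) * F x)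
    (hid : ∀ x : Fin 5 → V, StrictMono x →
      F x = 24 * G x + ∑ i : Fin 5, (-1 : ℤ) ^ (i : ℕ) * H (x ∘ i.succAbove))
    (x : Fin 5 → V) :
    F x = 24 * 𝐀₅⟦G, x⟧ + ∑ i : Fin 5, (-1 : ℤ) ^ (i : ℕ) * 𝐀₄⟦H, x ∘ i.succAbove⟧ := by
  classical
  by_cases hx : Function.Injective x
  · set ρ₀ : Equiv.Perm (Fin 5) := Tuple.sort x with hρ₀
    have hs : StrictMono (x ∘ ⇑ρ₀) :=
      (Tuple.monotone_sort x).strictMono_of_injective (hx.comp ρ₀.injective)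
    have ex : x = (x ∘ ⇑ρ₀) ∘ ⇑ρ₀⁻¹ := by
      funext k; simp
    have h1 : F x = ((Equiv.Perm.sign ρ₀⁻¹ : ℤˣ) : ℤ) * F (x ∘ ⇑ρ₀) := by
      conv_lhs => rw [ex]
      exact hF _ _
    have h2 : 𝐀₅⟦G, x⟧ = ((Equiv.Perm.sign ρ₀⁻¹ : ℤˣ) : ℤ) * G (x ∘ ⇑ρ₀) := by
      conv_lhs => rw [ex]
      rw [antisym₅_comp_perm, antisym₅_of_strictMono G hs]
    have h3 : ∑ i : Fin 5, (-1 : ℤ) ^ (i : ℕ) * 𝐀₄⟦H, x ∘ i.succAbove⟧ =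
        ((Equiv.Perm.sign ρ₀⁻¹ : ℤˣ) : ℤ) *
          ∑ i : Fin 5, (-1 : ℤ) ^ (i : ℕ) * H ((x ∘ ⇑ρ₀) ∘ i.succAbove) := by
      conv_lhs => rw [ex]
      rw [faceSum_comp_perm]
      congr 1
      refine Finset.sum_congr rfl fun i _ => ?_
      rw [antisym₄_of_strictMono H (hs.comp (Fin.strictMono_succAbove i))]
    rw [h1, h2, h3, hid _ hs]
    ring
  · have hF0 : F x = 0 := eq_zero_of_alternating F hF hx
    have hG0 : 𝐀₅⟦G, x⟧ = 0 :=
      eq_zero_of_alternating (fun x => 𝐀₅⟦G, x⟧) (fun x τ => antisym₅_comp_perm G x τ) hx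
    have hH0 : ∑ i : Fin 5, (-1 : ℤ) ^ (i : ℕ) * 𝐀₄⟦H, x ∘ i.succAbove⟧ = 0 :=
      eq_zero_of_alternating (fun x => ∑ i : Fin 5, (-1 : ℤ) ^ (i : ℕ) * 𝐀₄⟦H, x ∘ i.succAbove⟧)
        (fun x τ => faceSum_comp_perm H x τ) hx
    rw [hF0, hG0, hH0]; simp

/-! ## §5 Translation invariance (ordered additive groups) -/

/-- In an ordered additive group, `𝐀₄H` is translation invariant when `H` is (the order is translation invariant,
so the same `ρ` sorts `y` and `y + t`). [folklore] -/
theorem antisym₄_add_const {W : Type*} [AddCommGroup W] [LinearOrder W] [IsOrderedAddMonoid W]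
    (H : (Fin 4 → W) → ℤ) (hH : ∀ (y : Fin 4 → W) (t : W), H (fun k => y k + t) = H y)
    (y : Fin 4 → W) (t : W) :
    𝐀₄⟦H, fun k => y k + t⟧ = 𝐀₄⟦H, y⟧ := by
  classical
  refine Finset.sum_congr rfl fun ρ _ => ?_
  have hc : (fun k => y k + t) ∘ ⇑ρ = fun k => (y ∘ ⇑ρ) k + t := rfl
  have hiff : StrictMono ((fun k => y k + t) ∘ ⇑ρ) ↔ StrictMono (y ∘ ⇑ρ) := by
    constructor
    · intro h a b hab
      have h1 := h hab
      simp only [Function.comp_apply] at h1 ⊢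
      exact lt_of_add_lt_add_right h1
    · intro h a b hab
      have h1 := h hab
      simp only [Function.comp_apply] at h1 ⊢
      exact add_lt_add_left h1 t
  by_cases h : StrictMono (y ∘ ⇑ρ)
  · rw [if_pos (hiff.mpr h), if_pos h, hc, hH]
  · rw [if_neg (mt hiff.mp h), if_neg h]

end Summit.HodgeConjecture.HodgeConjecture.Theorems.TropicalWeilVanishing.Integrality
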